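import Literature.NumberTheory.EllipticCurves.LatticeInclusionDescentProofs
import Literature.NumberTheory.EllipticCurves.RealLatticePeriod
import Mathlib.RingTheory.Polynomial.Wronskian

/-!
# `XMapKernel`, line `isogeny-orbit-collapse` — stub **R-a**: rational lattice multiplier ⇒ datum

Support file for the crux `IsogenyCertificates.XMapKernel` (stmt-KontsevichZagierPeriods-10663),
line `isogeny-orbit-collapse`, stub `stub_datumOfRatMult` (R-a: a non-zero rational lattice
multiplier between the period lattices is realised by an x-rational isogeny datum).

**Statement.** Let `y² = x³ + Ax + B` and `y² = x³ + A'x + B'` be integral short Weierstrass cubics,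
`Λ` and `Λ'` period lattices with invariants `g₂ = −4A, g₃ = −4B` and `g₂' = −4A', g₃' = −4B'`
(the normalisation `℘ = x`, `℘' = 2y`), and `k ∈ ℚˣ` with `kΛ ⊆ Λ'`. Then there is an x-rational
isogeny datum `(f, g, c)`, `f, g ∈ ℚ[X]`, `c ∈ ℚ`, in the crux's literal shape:
`W := f'g − fg' ≠ 0` and `c²·g·(f³ + A'fg² + B'g³) = (X³ + AX + B)·W²`.

**Proof.** `kΛ ⊆ Λ'` says `Λ ⊆ k⁻¹Λ' =: Λ″` (the tree's homothetic pair `PeriodPair.mulLeft`), and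
`g₂(Λ″) = k⁴g₂' = −4k⁴A'`, `g₃(Λ″) = k⁶g₃' = −4k⁶B'` are rational. The tree's descent theorem
`PeriodPair.exists_rat_polynomial_weierstrassP_mul_eval_eq_of_le` (Silverman *AEC* VI.4.1 with the
`Aut(ℂ)`-descent of Cox §10.C) gives coprime `P₀, Q₀ ∈ ℚ[X]`, `Q₀` monic, with
`℘_{Λ″}·Q₀(℘_Λ) = P₀(℘_Λ)`, and `PeriodPair.transformation_polynomial_identity` gives, in `ℂ[X]`,
`W₀²·(4X³ + 4AX + 4B) = Q₀·(4P₀³ + 4k⁴A'P₀Q₀² + 4k⁶B'Q₀³)` (`W₀ = P₀'Q₀ − P₀Q₀'`), which is pulled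
back to `ℚ[X]` along the injection `Polynomial.map (algebraMap ℚ ℂ)` and divided by `4`. The datum
is `f := P₀`, `g := k²·Q₀`, `c := k` (a `linear_combination`). Finally `W₀ ≠ 0`: `Q₀ ≠ 0` and
`deg Q₀ < deg P₀` (`PeriodPair.natDegree_lt_of_weierstrassP_mul_eval_eq`, the pole of the isogeny at
`O`), while for coprime `P₀, Q₀` over a field of characteristic `0` the vanishing of the Wronskian
forces `P₀' = 0` (Mathlib's `IsCoprime.wronskian_eq_zero_iff`), i.e. `deg P₀ = 0`.

The nonsingularity hypotheses `4A³ + 27B² ≠ 0`, `4A'³ + 27B'² ≠ 0` of the registered signature are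
not needed by the argument. No new definitions; no named facts are used.

References: Silverman, *The Arithmetic of Elliptic Curves* (2009), Thm. VI.4.1, Cor. VI.5.1.1;
Cox, *Primes of the form x² + ny²* (2013), §10.C.
-/

noncomputable section

namespace Summit.KontsevichZagierPeriods.IsogenyCertificates.XMapKernelStubs.DatumOfRatMult

open Polynomial

/-- **Non-vanishing of the Wronskian.** For coprime `P, Q ∈ K[X]` over a field of characteristic
zero with `deg Q < deg P`, the Wronskian `P'Q − PQ'` is nonzero: otherwise
`IsCoprime.wronskian_eq_zero_iff` gives `P' = 0`, i.e. `deg P = 0`. [folklore] -/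
theorem wronskian_ne_zero {K : Type*} [Field K] [CharZero K] {P Q : K[X]} (hcop : IsCoprime P Q)
    (hdeg : Q.natDegree < P.natDegree) : derivative P * Q - P * derivative Q ≠ 0 := by
  intro h0
  have hw : wronskian P Q = 0 := by
    rw [wronskian]
    linear_combination -h0
  obtain ⟨hP', -⟩ := hcop.wronskian_eq_zero_iff.mp hw
  rw [derivative_eq_zero] at hP'
  omega

/-- **The transformation identity over `ℚ` for a rational lattice multiplier.** If `k ∈ ℚˣ`,
`kΛ ⊆ Λ'`, and the invariants are `g₂ = −4A, g₃ = −4B`, `g₂' = −4A', g₃' = −4B'` with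
`A, B, A', B' ∈ ℤ`, then there are coprime `P₀, Q₀ ∈ ℚ[X]` with `deg Q₀ < deg P₀` and
`(P₀'Q₀ − P₀Q₀')²·(X³ + AX + B) = Q₀·(P₀³ + k⁴A'·P₀Q₀² + k⁶B'·Q₀³)` in `ℚ[X]`: the descent theorem
`PeriodPair.exists_rat_polynomial_weierstrassP_mul_eval_eq_of_le` for `Λ ⊆ k⁻¹Λ'` and the algebraic
form `PeriodPair.transformation_polynomial_identity` of the transformation, pulled back along
`ℚ[X] ↪ ℂ[X]`. (Silverman, *AEC*, Thm. VI.4.1 (b), with the `Aut(ℂ)`-descent of Cox §10.C.)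
[cite: SilvermanAEC2009, Thm. VI.4.1] -/
theorem exists_rat_transformation_identity (A B A' B' : ℤ) (L L' : PeriodPair) (k : ℚ)
    (hL2 : L.g₂ = -4 * (A : ℂ)) (hL3 : L.g₃ = -4 * (B : ℂ)) (hL'2 : L'.g₂ = -4 * (A' : ℂ))
    (hL'3 : L'.g₃ = -4 * (B' : ℂ)) (hk : k ≠ 0) (hmul : ∀ l ∈ L.lattice, (k : ℂ) * l ∈ L'.lattice) :
    ∃ P₀ Q₀ : ℚ[X], IsCoprime P₀ Q₀ ∧ Q₀.natDegree < P₀.natDegree ∧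
      (derivative P₀ * Q₀ - P₀ * derivative Q₀) ^ 2 * (X ^ 3 + C (A : ℚ) * X + C (B : ℚ)) =
        Q₀ * (P₀ ^ 3 + C k ^ 4 * C (A' : ℚ) * P₀ * Q₀ ^ 2 + C k ^ 6 * C (B' : ℚ) * Q₀ ^ 3) := by
  have hkC : (k : ℂ) ≠ 0 := by exact_mod_cast hk
  have hc : (k : ℂ)⁻¹ ≠ 0 := inv_ne_zero hkC
  -- the lattice `Λ'' = k⁻¹ Λ' ⊇ Λ`, with invariants `k⁴ g₂'`, `k⁶ g₃'`
  obtain ⟨L'', hle, hg₂, hg₃⟩ : ∃ L'' : PeriodPair, L.lattice ≤ L''.lattice ∧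
      L''.g₂ = (k : ℂ) ^ 4 * (-4 * (A' : ℂ)) ∧ L''.g₃ = (k : ℂ) ^ 6 * (-4 * (B' : ℂ)) := by
    refine ⟨L'.mulLeft (k : ℂ)⁻¹ hc, fun x hx ↦ ?_, ?_, ?_⟩
    · rw [PeriodPair.mem_mulLeft_lattice, inv_inv]
      exact hmul x hx
    · rw [PeriodPair.g₂_mulLeft, hL'2, inv_pow, inv_inv]
    · rw [PeriodPair.g₃_mulLeft, hL'3, inv_pow, inv_inv]
  have h₂ : ∃ q : ℚ, (q : ℂ) = L.g₂ := ⟨-4 * A, by rw [hL2]; push_cast; ring⟩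
  have h₃ : ∃ q : ℚ, (q : ℂ) = L.g₃ := ⟨-4 * B, by rw [hL3]; push_cast; ring⟩
  have h₂' : ∃ q : ℚ, (q : ℂ) = L''.g₂ := ⟨k ^ 4 * (-4 * A'), by rw [hg₂]; push_cast; ring⟩
  have h₃' : ∃ q : ℚ, (q : ℂ) = L''.g₃ := ⟨k ^ 6 * (-4 * B'), by rw [hg₃]; push_cast; ring⟩
  obtain ⟨P₀, Q₀, hmon, hcop, -, hPQ⟩ :=
    L.exists_rat_polynomial_weierstrassP_mul_eval_eq_of_le L'' hle h₂ h₃ h₂' h₃'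
  have hinj : Function.Injective (algebraMap ℚ ℂ) := (algebraMap ℚ ℂ).injective
  -- `deg Q₀ < deg P₀`
  have hdeg : Q₀.natDegree < P₀.natDegree := by
    have h := L.natDegree_lt_of_weierstrassP_mul_eval_eq L'' (hmon.map (algebraMap ℚ ℂ)).ne_zero hPQ
    rwa [natDegree_map_eq_of_injective hinj, natDegree_map_eq_of_injective hinj] at h
  -- the transformation identity in `ℂ[X]`, pulled back to `ℚ[X]` and divided by `4`
  have hid := L.transformation_polynomial_identity L'' hle hPQ
  rw [hL2, hL3, hg₂, hg₃] at hid
  simp only [derivative_map, C_mul, C_neg, C_pow, map_ofNat] at hid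
  refine ⟨P₀, Q₀, hcop, hdeg, ?_⟩
  apply mul_left_cancel₀ (by norm_num : (4 : ℚ[X]) ≠ 0)
  apply Polynomial.map_injective (algebraMap ℚ ℂ) hinj
  simp only [Polynomial.map_mul, Polynomial.map_add, Polynomial.map_sub, Polynomial.map_pow,
    Polynomial.map_C, Polynomial.map_X, Polynomial.map_ofNat, eq_ratCast, Rat.cast_intCast]
  linear_combination hid

/-- **R-a — a rational lattice multiplier is realised by an x-rational isogeny datum.** For integral
short Weierstrass cubics `y² = x³ + Ax + B`, `y² = x³ + A'x + B'` (nonsingular), period pairs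
`L, L'` with `g₂(L) = −4A, g₃(L) = −4B, g₂(L') = −4A', g₃(L') = −4B'`, and `k ∈ ℚ`, `k ≠ 0`, with
`k·Λ_L ⊆ Λ_{L'}`, there are `f, g ∈ ℚ[X]`, `c ∈ ℚ` with `f'g − fg' ≠ 0` and
`c²·g·(f³ + A'fg² + B'g³) = (X³ + AX + B)·(f'g − fg')²`: with `P₀, Q₀` from
`exists_rat_transformation_identity`, take `f = P₀`, `g = k²Q₀`, `c = k`; the Wronskian is
`k²·(P₀'Q₀ − P₀Q₀') ≠ 0` by `wronskian_ne_zero`. (The `x`-coordinate of the isogeny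
`ℂ/Λ → ℂ/k⁻¹Λ'`, `z ↦ z`, is defined over `ℚ`: Silverman, *AEC*, Thm. VI.4.1 (b), VI.5.3.)
[cite: SilvermanAEC2009, Thm. VI.4.1] -/
theorem stub_datumOfRatMult : ∀ (A B A' B' : ℤ), 4 * A ^ 3 + 27 * B ^ 2 ≠ 0 → 4 * A' ^ 3 + 27 * B' ^ 2 ≠ 0 → ∀ (L L' : PeriodPair) (k : ℚ), L.g₂ = -4 * (A : ℂ) → L.g₃ = -4 * (B : ℂ) → L'.g₂ = -4 * (A' : ℂ) → L'.g₃ = -4 * (B' : ℂ) → k ≠ 0 → (∀ l ∈ L.lattice, (k : ℂ) * l ∈ L'.lattice) → ∃ (f g : Polynomial ℚ) (c : ℚ), Polynomial.derivative f * g - f * Polynomial.derivative g ≠ 0 ∧ Polynomial.C (c ^ 2) * g * (f ^ 3 + Polynomial.C (A' : ℚ) * f * g ^ 2 + Polynomial.C (B' : ℚ) * g ^ 3) = (Polynomial.X ^ 3 + Polynomial.C (A : ℚ) * Polynomial.X + Polynomial.C (B : ℚ)) * (Polynomial.derivative f * g - f * Polynomial.derivative g) ^ 2 := by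
  intro A B A' B' _ _ L L' k hL2 hL3 hL'2 hL'3 hk hmul
  obtain ⟨P₀, Q₀, hcop, hdeg, hidQ⟩ :=
    exists_rat_transformation_identity A B A' B' L L' k hL2 hL3 hL'2 hL'3 hk hmul
  have hW₀ : derivative P₀ * Q₀ - P₀ * derivative Q₀ ≠ 0 := wronskian_ne_zero hcop hdeg
  have hW : derivative P₀ * (C (k ^ 2) * Q₀) - P₀ * (C (k ^ 2) * derivative Q₀) =
      C (k ^ 2) * (derivative P₀ * Q₀ - P₀ * derivative Q₀) := by ring
  refine ⟨P₀, C (k ^ 2) * Q₀, k, ?_, ?_⟩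
  · rw [derivative_C_mul, hW]
    exact mul_ne_zero (C_ne_zero.mpr (pow_ne_zero 2 hk)) hW₀
  · rw [derivative_C_mul, hW, C_pow]
    linear_combination (-(C k ^ 4)) * hidQ

end Summit.KontsevichZagierPeriods.IsogenyCertificates.XMapKernelStubs.DatumOfRatMult

end
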